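import Literature.AnabelianGeometry.EtaleTheta.GalSectCor28iiEndKnit
import HarnessLib

/-!
# [EtTh] Cor. 2.8 (ii) — the stabilisation input `Γ(D_C) = h·D_C·h⁻¹` DERIVED from the X-level cusp
# transport (`D_C` is a normaliser; normalisers are functorial) (proof-only)

Mochizuki, *The étale theta function …* [EtTh], Publ. RIMS **45** (2009), Cor. 2.8 (ii) p.268, Cor. 2.9 p.269
[cite: MochizukiEtTh2009, Cor 2.8 (ii) p.42].  abc-iut cell, layer L2, seat abc-iut-w5-d062 (gen 3); sequel to
`GalSectCor28iiEndKnit.lean` (p436362).  PROOF-ONLY: no definitions, no named facts.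

In `cor28iiAt_of_equivariantFamily` (p436362) the automorphisms `Γ` of the list `L` must carry abc-iut-L2-t2's
cusp stabiliser `cuspStabC = N_{Π^tp_C}(Π^tp-pull-back of D_x)` to a conjugate.  Since `cuspStabC` is DEFINED
as a normaliser and normalisers commute with isomorphisms (Mathlib `Subgroup.map_equiv_normalizer_eq`), this
input follows from the X-LEVEL cusp transport `Γ(tp D_x) = h·(tp D_x)·h⁻¹` (decomposition groups of cusps
are carried to conjugates: [SemiAnbd] Thm. 6.5 (iii) / [AbsTopI] Lem. 4.5 genre — the same shape as the
`(x)` input of `GalSectThm110iiiCuspPairTransport.lean` for Thm. 1.10 (iii)):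

* `normalizer_conj_smul` — `N(h·H·h⁻¹) = h·N(H)·h⁻¹`;
* `TemperedCoverData.cuspStabC_map_eq_of_tpDx` — `Γ(D_C) = h·D_C·h⁻¹` from `Γ(tp D_x) = h·(tp D_x)·h⁻¹`;
* **`TemperedCoverData.cor28iiAt_of_equivariantFamily_of_tpDx`** — `Cor28iiAt` from: `L`-automorphisms
  stabilise the member `S` and `Δ^tp_C` and carry `tp D_x` to a conjugate, plus THE equivariant family.

HONEST FRAMING: the equivariant family and the X-level transport are INPUTS; typed ≠ proved; no side taken
on [IUTchIII] Cor. 3.12, on which nothing here bears.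
-/

noncomputable section

namespace Literature.AnabelianGeometry.EtaleTheta

open scoped Pointwise

section GroupTheory

variable {G G' : Type*} [Group G] [Group G']

/-- **Normalisers commute with conjugation**: `N(h·H·h⁻¹) = h·N(H)·h⁻¹` (pointwise conjugation is the image
under the inner automorphism — `Literature.IUT.HodgeArakelov.conj_smul_eq_map_conj`, re-derived inline to keep
the L2 import graph free of L6 — and normalisers commute with isomorphisms). [cite: MochizukiEtTh2009, Cor 2.9 p.43] -/
theorem normalizer_conj_smul (h : G) (H : Subgroup G) :
    Subgroup.normalizer ((MulAut.conj h • H : Subgroup G) : Set G) =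
      MulAut.conj h • Subgroup.normalizer (H : Set G) := by
  have hmap : ∀ K : Subgroup G, MulAut.conj h • K = K.map (MulAut.conj h).toMonoidHom := by
    intro K
    ext x
    rw [Subgroup.mem_smul_pointwise_iff_exists, Subgroup.mem_map]
    constructor
    · rintro ⟨y, hy, rfl⟩; exact ⟨y, hy, rfl⟩
    · rintro ⟨y, hy, rfl⟩; exact ⟨y, hy, rfl⟩
  rw [hmap, hmap, Subgroup.map_equiv_normalizer_eq]

/-- **Normalisers commute with isomorphisms** (Mathlib, restated for `≃ₜ*` in the tree's `map` form).
[cite: MochizukiEtTh2009, Cor 2.9 p.43] -/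
theorem normalizer_map_continuousMulEquiv [TopologicalSpace G] [TopologicalSpace G'] (Γ : G ≃ₜ* G')
    (H : Subgroup G) :
    (Subgroup.normalizer (H : Set G)).map Γ.toMulEquiv.toMonoidHom =
      Subgroup.normalizer ((H.map Γ.toMulEquiv.toMonoidHom : Subgroup G') : Set G') :=
  Subgroup.map_equiv_normalizer_eq H Γ.toMulEquiv

end GroupTheory

namespace ThetaCovers

namespace TemperedCoverData

universe u

variable {l : ℕ} (T : TemperedCoverData.{u} l)

/-- **`Γ(D_C) = h·D_C·h⁻¹` from the X-level cusp transport**: if `Γ` carries the `Π^tp`-pull-back `tp D_x` of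
the decomposition group of the cusp `x` of `X` to `h·(tp D_x)·h⁻¹`, then it carries the cusp stabiliser
`D_C = N_{Π^tp_C}(tp D_x)` to `h·D_C·h⁻¹`. [cite: MochizukiEtTh2009, Cor 2.9 p.43] -/
theorem cuspStabC_map_eq_of_tpDx (Γ : T.Gtp ≃ₜ* T.Gtp) {h : T.Gtp}
    (hDx : (T.tp T.Dx).map Γ.toMulEquiv.toMonoidHom = MulAut.conj h • T.tp T.Dx) :
    T.cuspStabC.map Γ.toMulEquiv.toMonoidHom = MulAut.conj h • T.cuspStabC := by
  unfold cuspStabC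
  rw [normalizer_map_continuousMulEquiv, hDx, normalizer_conj_smul]

/-- **[EtTh] Cor. 2.8 (ii) END-KNIT with the stabilisation data read at the X-level**: `Cor28iiAt S L n 𝒟`
from (stab) every `L`-automorphism stabilises the member `S` and `Δ^tp_C` ([AbsAnab] Lem. 1.3.8 genre) and
carries `tp D_x` to a conjugate (decomposition groups of cusps are carried to conjugates, [SemiAnbd] Thm. 6.5
(iii) / [AbsTopI] Lem. 4.5 genre), and THE equivariant family `R` of `μ_n`-sub-structures (the substantive
input, = print's `η̈`-determined structures).  [cite: MochizukiEtTh2009, Cor 2.8 (ii) p.42] -/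
theorem cor28iiAt_of_equivariantFamily_of_tpDx (S : Subgroup T.Gtp) (L : List (Subgroup T.Gtp)) (n : ℕ)
    {A : Type u} [Group A] (𝒟 : T.Cor28iiData S A)
    (hstab : ∀ Γ : T.Gtp ≃ₜ* T.Gtp, (∀ S' ∈ L, S'.map Γ.toMulEquiv.toMonoidHom = S') →
      S.map Γ.toMulEquiv.toMonoidHom = S ∧ T.DeltaTp.map Γ.toMulEquiv.toMonoidHom = T.DeltaTp ∧
        ∃ h : T.Gtp, (T.tp T.Dx).map Γ.toMulEquiv.toMonoidHom = MulAut.conj h • T.tp T.Dx)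
    (R : ∀ g : T.Gtp, Set (T.cuspPairAt S g).SplittingClass)
    (hR : ∀ g, (𝒟.torsor g).IsSubStructure (𝒟.mu n) (𝒟.canonical g) (R g))
    (hReq : ∀ (Γ : T.Gtp ≃ₜ* T.Gtp) (g g' : T.Gtp)
        (e : (T.cuspPairAt S g).SplittingClass → (T.cuspPairAt S g').SplittingClass),
      (∀ S' ∈ L, S'.map Γ.toMulEquiv.toMonoidHom = S') →
      (T.cuspPairAt S g).map Γ = T.cuspPairAt S g' →
      (∀ (S₁ : Subgroup T.Gtp) (hS₁ : S₁ ∈ (T.cuspPairAt S g).splittings),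
        ∃ h', e (GalSect.CuspPair.SplittingClass.mk _ S₁ hS₁) =
          GalSect.CuspPair.SplittingClass.mk _ (S₁.map Γ.toMulEquiv.toMonoidHom) h') →
      e '' R g = R g') :
    T.Cor28iiAt S L n 𝒟 :=
  T.cor28iiAt_of_equivariantFamily S L n 𝒟
    (fun Γ hΓ => by
      obtain ⟨hS, hΔ, h, hDx⟩ := hstab Γ hΓ
      exact ⟨hS, hΔ, h, T.cuspStabC_map_eq_of_tpDx Γ hDx⟩)
    R hR hReq

end TemperedCoverData

end ThetaCovers

end Literature.AnabelianGeometry.EtaleTheta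

end
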